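import Literature.Computability.Cryptography.Harvey2021Integer
import HarnessLib

/-!
# Harvey 2021: the main search as a function, and its correctness

Continuing `Harvey2021Integer.lean` (`cab`, `Jab`, `bsgs_witness`, `lemma31_integer`) and
`Harvey2021.lean` (`exists_not_isUnit_of_prod_eq_zero`).  Harvey's Algorithm 2 (the baby-step /
giant-step search for `u = aq + bp`, Prop. 4.2) followed by Algorithm 1 (collisions modulo `p`
or `q`, Prop. 4.1) is written here as ONE pure function `bsgsOut N α m r : Option ℕ` in the
simplified, machine-friendly form that the `N^{1/5+o(1)}` bound permits (the `o(1)` absorbs all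
logarithmic factors, `Harvey2021Bridge.lean`), and proved correct:

* **inverse-free** (no `α^{-1} mod N`): with `J* = J_{1,1} ≥ J_{a,b}` and `C = α^{(J*−1)m}`, the
  baby steps are `C α^i mod N` (`baby`) and the giant steps `t_{a,b} · α^{(J*−1−j)m} mod N`
  (`giant`, `tval`; `triples` lists `(a, b, j)`, `1 ≤ ab ≤ r`, `j < J_{a,b}`);
* **no Step 1**: the order certificate of the base `α` is per prime factor (`α^x ≢ 1 (mod p)` for
  `1 ≤ x < m` and every prime `p ∣ N`, as supplied by the order search), which is what the
  proof of Prop. 4.2 uses Step 1 for;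
* **one sort of one list**: entries `(2·key + flag)·P + payload` (`entry`, `ekey`, `eflag`,
  `epay`), babies flagged `0`, giants `1`, sorted as numbers (`sorted`); **one linear scan**
  (`scanStep`, `scanAll`) remembering the last baby key: a giant with that key is an exact match
  `v_{a,b,j} = C α^i (mod N)` and is handed to the integer recovery of Lemma 3.1 (`recover`,
  `u = i + jm + c_{ab}`), any other giant joins the value list;
* **general multipoint evaluation** instead of Bluestein: `f = ∏ (X − v)` over the value list
  (`fpoly`) evaluated at the baby steps (`vals`), the first `i` with `gcd(f(Cα^i), N) > 1`, and —
  if that gcd is `N` — the scan of `gcd(N, Cα^i − v_h)` (`alg1`).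

Results: **`bsgsOut_sound`** (a reported number is a proper factor of `N`) and
**`bsgsOut_complete`**: for `N = pq`, `p < q` primes, `r < p`, `(N/r)^{1/2} ≤ p`, and `α`
coprime to `N` with the certificate above, `bsgsOut N α m r` reports a factor.  The proof is
Harvey's (proof of Prop. 4.2, then of Prop. 4.1): `bsgs_witness` gives `(a₀, b₀, i₀, j₀)` with
`C α^{i₀} ≡ v_{a₀,b₀,j₀} (mod p)`; if the two residues are equal modulo `N` the scan meets the
match and Lemma 3.1 splits `N` (`found_of_exact`, `lemma31_integer`); otherwise `v_{a₀,b₀,j₀}`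
equals no baby step (else `α^{|i−i₀|} ≡ 1 (mod p)`), so it is in the value list
(`mem_vlist_iff`), `p ∣ f(Cα^{i₀})`, and at the first hit either the gcd is proper or `f`
vanishes modulo `N` and a product of nonzero residues being zero exhibits a non-unit factor
(`exists_not_isUnit_of_prod_eq_zero`).  The sorted-scan lemma `matched_iff_of_sorted` (a giant
is matched iff its key is a baby key, and then the remembered index is that baby's) is the only
place where sortedness is used.  No named facts.

## References

* D. Harvey, *An exponent one-fifth algorithm for deterministic integer factorisation*,
  Math. Comp. 90 (2021) 2937–2950, §4: Algorithms 1–2, Prop. 4.1 (arXiv:2010.05450 Prop. 14) and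
  Prop. 4.2 (arXiv Prop. 15) with their proofs; Lemma 3.1 (arXiv Lemma 10). [Harvey2021]
* M. Hittmeir, *A time-space tradeoff for Lehman's deterministic integer factorization method*,
  Math. Comp. 90 (2021) 1999–2010 (arXiv:2006.16729): the sort-and-match search. (Folklore
  material as used here, fully proved.)
-/

namespace Literature.Computability.Cryptography.Harvey2021

open Real Polynomial

namespace SearchModel

/-- `J_{a,b} ≤ J_{1,1}` for `a, b ≥ 1` (so `J* = J_{1,1}` bounds every giant-step count). [folklore] -/
theorem Jab_le_Jab_one {N r m a b : ℕ} (ha : 0 < a) (hb : 0 < b) : Jab N r m a b ≤ Jab N r m 1 1 := by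
  unfold Jab
  have hab : 1 ≤ Nat.sqrt (a * b) := Nat.le_sqrt.2 (by nlinarith)
  simp only [mul_one, Nat.sqrt_one]
  rcases Nat.eq_zero_or_pos (4 * r * m) with h0 | h0
  · simp [h0]
  · exact Nat.succ_le_succ (Nat.div_le_div_left (Nat.le_mul_of_pos_right _ hab |> le_trans (le_refl _)) h0)

/-! ### the functional model -/

section Model

variable (N α m r : ℕ)

/-- `J* = J_{1,1}`, an upper bound of all `J_{a,b}`. [folklore] -/
def Jmax : ℕ := Jab N r m 1 1

/-- The common factor `C = α^{(J*−1) m} mod N` making the search inverse-free. [folklore] -/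
def Cst : ℕ := α ^ ((Jmax N m r - 1) * m) % N

/-- Baby step `i`: `C α^i mod N`. [folklore] -/
def baby (i : ℕ) : ℕ := (Cst N α m r * (α ^ i % N)) % N

/-- The pairs `(a, b)`, `1 ≤ a ≤ r`, `1 ≤ b ≤ r/a`, in generation order. [folklore] -/
def pairs : List (ℕ × ℕ) := (List.range r).flatMap fun a' => (List.range (r / (a' + 1))).map fun b' => (a' + 1, b' + 1)

/-- The triples `(a, b, j)`, `j < J_{a,b}`, in generation order. [folklore] -/
def triples : List (ℕ × ℕ × ℕ) :=
  (pairs r).flatMap fun ab => (List.range (Jab N r m ab.1 ab.2)).map fun j => (ab.1, ab.2, j)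

/-- `t_{a,b} = α^{aN + b − c_{ab}} mod N`. [folklore] -/
def tval (a b : ℕ) : ℕ := α ^ (a * N + b - cab N a b) % N

/-- Giant step `(a, b, j)`: `t_{a,b} · α^{(J*−1−j) m} mod N`. [folklore] -/
def giant (t : ℕ × ℕ × ℕ) : ℕ := (tval N α t.1 t.2.1 * (α ^ ((Jmax N m r - 1 - t.2.2) * m) % N)) % N

/-- Payload modulus: a power of two above `m` and the number of triples. [folklore] -/
def P : ℕ := 2 ^ (m + (triples N m r).length).size

/-- Entry code `(key, flag, payload) ↦ (2 key + flag) P + payload`. [folklore] -/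
def entry (key flag payload : ℕ) : ℕ := (2 * key + flag) * P N m r + payload

/-- Decoding. [folklore] -/
def ekey (e : ℕ) : ℕ := e / P N m r / 2
/-- Decoding. [folklore] -/
def eflag (e : ℕ) : ℕ := e / P N m r % 2
/-- Decoding. [folklore] -/
def epay (e : ℕ) : ℕ := e % P N m r

/-- The baby entries then the giant entries, in generation order. [folklore] -/
def entries : List ℕ :=
  ((List.range m).map fun i => entry N m r (baby N α m r i) 0 i) ++
    ((List.range (triples N m r).length).map fun h => entry N m r (giant N α m r ((triples N m r).getD h (0, 0, 0))) 1 h)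

/-- The sorted entries. [folklore] -/
def sorted : List ℕ := (entries N α m r).insertionSort (· ≤ ·)

/-- Lemma 3.1 in integer arithmetic: from `u ?= aq + bp` try to split `N`. [folklore] -/
def recover (a b u : ℕ) : Option ℕ :=
  if 4 * a * b * N ≤ u * u then
    if Nat.sqrt (u * u - 4 * a * b * N) * Nat.sqrt (u * u - 4 * a * b * N) = u * u - 4 * a * b * N then
      if 1 < Nat.gcd ((u + Nat.sqrt (u * u - 4 * a * b * N)) / 2) N ∧ Nat.gcd ((u + Nat.sqrt (u * u - 4 * a * b * N)) / 2) N < N then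
        some (Nat.gcd ((u + Nat.sqrt (u * u - 4 * a * b * N)) / 2) N)
      else none
    else none
  else none

/-- The state of the scan of the sorted entries. [folklore] -/
structure ScanSt where
  lastKey : Option ℕ
  lastI : ℕ
  found : Option ℕ
  vlist : List ℕ

/-- One entry of the scan. [folklore] -/
def scanStep (st : ScanSt) (e : ℕ) : ScanSt :=
  if eflag N m r e = 0 then { st with lastKey := some (ekey N m r e), lastI := epay N m r e }
  else
    let t := (triples N m r).getD (epay N m r e) (0, 0, 0)
    if st.lastKey = some (ekey N m r e) then
      match st.found with
      | some _ => st
      | none => { st with found := recover N t.1 t.2.1 (st.lastI + t.2.2 * m + cab N t.1 t.2.1) }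
    else { st with vlist := st.vlist ++ [ekey N m r e] }

/-- The whole scan. [folklore] -/
def scanAll : ScanSt := (sorted N α m r).foldl (scanStep N m r) ⟨none, 0, none, []⟩

/-- The polynomial vanishing on the unmatched giant steps. [folklore] -/
noncomputable def fpoly (vl : List ℕ) : (ZMod N)[X] := (vl.map fun v => X - C ((v : ℕ) : ZMod N)).prod

/-- Its values at the baby steps (as computed by multipoint evaluation). [folklore] -/
noncomputable def vals (vl : List ℕ) : List ℕ := (List.range m).map fun i => ((fpoly N vl).eval ((baby N α m r i : ℕ) : ZMod N)).val

/-- The collision search (Algorithm 1 with general multipoint evaluation). [folklore] -/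
noncomputable def alg1 (vl : List ℕ) : Option ℕ :=
  match (List.range m).find? (fun i => 1 < Nat.gcd ((vals N α m r vl).getD i 0) N) with
  | none => none
  | some i =>
    if Nat.gcd ((vals N α m r vl).getD i 0) N < N then some (Nat.gcd ((vals N α m r vl).getD i 0) N)
    else
      match vl.find? (fun v => 1 < Nat.gcd ((baby N α m r i + N - v) % N) N ∧ Nat.gcd ((baby N α m r i + N - v) % N) N < N) with
      | some v => some (Nat.gcd ((baby N α m r i + N - v) % N) N)
      | none => none

/-- **The outcome of the merged search**: the factor of the recovery, else of the collision search. [folklore] -/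
noncomputable def bsgsOut : Option ℕ := (scanAll N α m r).found <|> alg1 N α m r (scanAll N α m r).vlist

end Model

/-! ### soundness: a reported number is a proper factor -/

/-- A number reported by the recovery is a proper factor (it passed the test `1 < g < N` and is a gcd with `N`). [cite: Harvey2021, Lem. 3.1 (arXiv Lem. 10)] -/
theorem recover_sound {N a b u g : ℕ} (h : recover N a b u = some g) : 1 < g ∧ g < N ∧ g ∣ N := by
  unfold recover at h
  split_ifs at h with h1 h2 h3
  cases h
  exact ⟨h3.1, h3.2, Nat.gcd_dvd_right _ _⟩

/-- The scan only records proper factors. [folklore] -/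
theorem scanStep_found_sound {N m r : ℕ} (st : ScanSt) (e : ℕ) (hst : ∀ g, st.found = some g → 1 < g ∧ g < N ∧ g ∣ N) :
    ∀ g, (scanStep N m r st e).found = some g → 1 < g ∧ g < N ∧ g ∣ N := by
  intro g hg
  unfold scanStep at hg
  split_ifs at hg with h1 h2
  · exact hst g hg
  · revert hg
    cases hf : st.found with
    | some g0 => intro hg; exact hst g (by simpa [hf] using hg)
    | none => intro hg; simp only at hg; exact recover_sound hg
  · exact hst g hg

/-- The scan only records proper factors. [folklore] -/
theorem scanAll_found_sound {N α m r g : ℕ} (h : (scanAll N α m r).found = some g) : 1 < g ∧ g < N ∧ g ∣ N := by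
  unfold scanAll at h
  suffices H : ∀ (l : List ℕ) (st : ScanSt), (∀ g, st.found = some g → 1 < g ∧ g < N ∧ g ∣ N) →
      ∀ g, (l.foldl (scanStep N m r) st).found = some g → 1 < g ∧ g < N ∧ g ∣ N from
    H _ _ (by simp) g h
  intro l
  induction l with
  | nil => intro st hst g hg; exact hst g hg
  | cons e l ih => intro st hst g hg; exact ih _ (scanStep_found_sound st e hst) g hg

/-- The collision search only reports proper factors. [cite: Harvey2021, Prop. 4.1 (arXiv Prop. 14)] -/
theorem alg1_sound {N α m r : ℕ} {vl : List ℕ} {g : ℕ} (h : alg1 N α m r vl = some g) : 1 < g ∧ g < N ∧ g ∣ N := by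
  unfold alg1 at h
  split at h
  · cases h
  · rename_i i hi
    have hi' := List.find?_some hi
    simp only [decide_eq_true_eq] at hi'
    split_ifs at h with h1
    · cases h; exact ⟨hi', h1, Nat.gcd_dvd_right _ _⟩
    · split at h
      · rename_i v hv
        cases h
        have hv' := List.find?_some hv
        simp only [decide_eq_true_eq] at hv'
        exact ⟨hv'.1, hv'.2, Nat.gcd_dvd_right _ _⟩
      · cases h

/-- **Soundness**: every reported number is a proper factor of `N`. [folklore] -/
theorem bsgsOut_sound {N α m r g : ℕ} (h : bsgsOut N α m r = some g) : 1 < g ∧ g < N ∧ g ∣ N := by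
  unfold bsgsOut at h
  cases hf : (scanAll N α m r).found with
  | some g0 => rw [hf] at h; simp at h; subst h; exact scanAll_found_sound hf
  | none => rw [hf] at h; simp at h; exact alg1_sound h

/-! ### decoding, the entry lists, sortedness -/

section Decode

variable {N α m r : ℕ}

/-- The payload modulus is positive. [folklore] -/
theorem P_pos : 0 < P N m r := Nat.two_pow_pos _

/-- Payloads fit below the payload modulus. [folklore] -/
theorem lt_P_m : m + (triples N m r).length < P N m r := Nat.lt_size_self _

/-- Decoding the key of an entry. [folklore] -/
theorem ekey_entry {k f p : ℕ} (hf : f < 2) (hp : p < P N m r) : ekey N m r (entry N m r k f p) = k := by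
  unfold ekey entry
  rw [Nat.add_comm, Nat.add_mul_div_right _ _ P_pos, Nat.div_eq_of_lt hp, Nat.zero_add, Nat.mul_comm 2 k, Nat.add_comm,
    Nat.add_mul_div_right _ _ two_pos, Nat.div_eq_of_lt hf, Nat.zero_add]

/-- Decoding the flag of an entry. [folklore] -/
theorem eflag_entry {k f p : ℕ} (hf : f < 2) (hp : p < P N m r) : eflag N m r (entry N m r k f p) = f := by
  unfold eflag entry
  rw [Nat.add_comm, Nat.add_mul_div_right _ _ P_pos, Nat.div_eq_of_lt hp, Nat.zero_add, Nat.mul_comm 2 k,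
    Nat.add_comm, Nat.add_mul_mod_self_right, Nat.mod_eq_of_lt hf]

/-- Decoding the payload of an entry. [folklore] -/
theorem epay_entry {k f p : ℕ} (hp : p < P N m r) : epay N m r (entry N m r k f p) = p := by
  unfold epay entry
  rw [Nat.add_comm, Nat.add_mul_mod_self_right, Nat.mod_eq_of_lt hp]

/-- The key is monotone in the entry. [folklore] -/
theorem ekey_mono {e e' : ℕ} (h : e ≤ e') : ekey N m r e ≤ ekey N m r e' :=
  Nat.div_le_div_right (Nat.div_le_div_right h)

/-- A baby entry precedes a giant entry of the same key. [folklore] -/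
theorem entry_baby_lt_giant {k i h : ℕ} (hi : i < P N m r) : entry N m r k 0 i < entry N m r k 1 h := by
  unfold entry; have := P_pos (N := N) (m := m) (r := r); nlinarith

/-- Well-formed entries. [folklore] -/
def WF (N α m r : ℕ) (e : ℕ) : Prop :=
  (∃ i, i < m ∧ e = entry N m r (baby N α m r i) 0 i) ∨
    (∃ h, h < (triples N m r).length ∧ e = entry N m r (giant N α m r ((triples N m r).getD h (0, 0, 0))) 1 h)

/-- The entry list consists of the well-formed entries. [folklore] -/
theorem mem_entries_iff {e : ℕ} : e ∈ entries N α m r ↔ WF N α m r e := by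
  unfold entries WF
  simp only [List.mem_append, List.mem_map, List.mem_range]
  constructor
  · rintro (⟨i, hi, rfl⟩ | ⟨h, hh, rfl⟩)
    · exact Or.inl ⟨i, hi, rfl⟩
    · exact Or.inr ⟨h, hh, rfl⟩
  · rintro (⟨i, hi, rfl⟩ | ⟨h, hh, rfl⟩)
    · exact Or.inl ⟨i, hi, rfl⟩
    · exact Or.inr ⟨h, hh, rfl⟩

/-- Flags are `0` or `1`. [folklore] -/
theorem WF.flag_lt {e : ℕ} (h : WF N α m r e) : eflag N m r e < 2 := by
  have hP := lt_P_m (N := N) (m := m) (r := r)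
  rcases h with ⟨i, hi, rfl⟩ | ⟨h, hh, rfl⟩
  · rw [eflag_entry two_pos (by omega)]; exact two_pos
  · rw [eflag_entry one_lt_two (by omega)]; exact one_lt_two

/-- A well-formed entry with flag `0` is a baby entry. [folklore] -/
theorem WF.baby_of_flag {e : ℕ} (h : WF N α m r e) (hf : eflag N m r e = 0) :
    ∃ i, i < m ∧ e = entry N m r (baby N α m r i) 0 i ∧ ekey N m r e = baby N α m r i ∧ epay N m r e = i := by
  have hP := lt_P_m (N := N) (m := m) (r := r)
  rcases h with ⟨i, hi, rfl⟩ | ⟨h, hh, rfl⟩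
  · exact ⟨i, hi, rfl, ekey_entry two_pos (by omega), epay_entry (by omega)⟩
  · rw [eflag_entry one_lt_two (by omega)] at hf; exact absurd hf one_ne_zero

/-- A well-formed entry with flag `≠ 0` is a giant entry. [folklore] -/
theorem WF.giant_of_flag {e : ℕ} (h : WF N α m r e) (hf : eflag N m r e ≠ 0) :
    ∃ k, k < (triples N m r).length ∧ e = entry N m r (giant N α m r ((triples N m r).getD k (0, 0, 0))) 1 k ∧
      ekey N m r e = giant N α m r ((triples N m r).getD k (0, 0, 0)) ∧ epay N m r e = k := by
  have hP := lt_P_m (N := N) (m := m) (r := r)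
  rcases h with ⟨i, hi, rfl⟩ | ⟨k, hk, rfl⟩
  · rw [eflag_entry two_pos (by omega)] at hf; exact absurd rfl hf
  · exact ⟨k, hk, rfl, ekey_entry one_lt_two (by omega), epay_entry (by omega)⟩

/-- Entries are determined by flag and payload: the list has no duplicates. [folklore] -/
theorem nodup_entries : (entries N α m r).Nodup := by
  have hP := lt_P_m (N := N) (m := m) (r := r)
  unfold entries
  refine List.Nodup.append ?_ ?_ ?_
  · refine (List.nodup_range.map_on ?_)
    intro i hi i' hi' he
    simp only [List.mem_range] at hi hi'
    have := congrArg (epay N m r) he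
    rwa [epay_entry (by omega), epay_entry (by omega)] at this
  · refine (List.nodup_range.map_on ?_)
    intro i hi i' hi' he
    simp only [List.mem_range] at hi hi'
    have := congrArg (epay N m r) he
    rwa [epay_entry (by omega), epay_entry (by omega)] at this
  · intro e he1 he2
    simp only [List.mem_map, List.mem_range] at he1 he2
    obtain ⟨i, hi, rfl⟩ := he1
    obtain ⟨k, hk, he⟩ := he2
    have := congrArg (eflag N m r) he
    rw [eflag_entry one_lt_two (by omega), eflag_entry two_pos (by omega)] at this
    exact absurd this one_ne_zero

/-- Sorting permutes. [folklore] -/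
theorem sorted_perm : (sorted N α m r).Perm (entries N α m r) := List.perm_insertionSort _ _

/-- The sorted list consists of the well-formed entries. [folklore] -/
theorem mem_sorted_iff {e : ℕ} : e ∈ sorted N α m r ↔ WF N α m r e := by
  rw [(sorted_perm).mem_iff, mem_entries_iff]

/-- The sorted list is strictly increasing. [folklore] -/
theorem sorted_pairwise_lt : (sorted N α m r).Pairwise (· < ·) := by
  have h1 : (sorted N α m r).Pairwise (· ≤ ·) := List.pairwise_insertionSort (· ≤ ·) (entries N α m r)
  have h2 : (sorted N α m r).Nodup := (sorted_perm).nodup_iff.2 nodup_entries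
  exact List.Pairwise.imp_of_mem (R := fun a b => a ≤ b ∧ a ≠ b) (fun _ _ h => lt_of_le_of_ne h.1 h.2) (h1.and h2)

end Decode

/-! ### the scan as a fold: generic facts -/

section Fold

variable {N α m r : ℕ}

/-- The last baby entry of a list. [folklore] -/
def lastB (N m r : ℕ) (l : List ℕ) : Option ℕ := (l.filter fun e => eflag N m r e = 0).getLast?

/-- The key recorded after `pre`. [folklore] -/
def lastKeyOf (N m r : ℕ) (pre : List ℕ) : Option ℕ := (lastB N m r pre).map (ekey N m r)

/-- The index recorded after `pre`. [folklore] -/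
def lastIOf (N m r : ℕ) (pre : List ℕ) : ℕ := ((lastB N m r pre).map (epay N m r)).getD 0

/-- Whether the giant entry `e` is matched after `pre`. [folklore] -/
def matched (N m r : ℕ) (pre : List ℕ) (e : ℕ) : Prop := lastKeyOf N m r pre = some (ekey N m r e)

/-- Matching is decidable. [folklore] -/
instance (pre : List ℕ) (e : ℕ) : Decidable (matched N m r pre e) := by unfold matched; infer_instance

/-- The specification of the value list: keys of unmatched giant entries, in order. [folklore] -/
def vspec (N m r : ℕ) : List ℕ → List ℕ → List ℕ
  | _, [] => []
  | pre, e :: l => (if eflag N m r e = 0 then [] else if matched N m r pre e then [] else [ekey N m r e]) ++ vspec N m r (pre ++ [e]) l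

/-- The last baby entry after one more entry. [folklore] -/
theorem lastB_append_singleton (l : List ℕ) (e : ℕ) :
    lastB N m r (l ++ [e]) = if eflag N m r e = 0 then some e else lastB N m r l := by
  unfold lastB
  rw [List.filter_append]
  by_cases h : eflag N m r e = 0
  · simp [h]
  · simp [h]

/-- The value-list specification over a concatenation. [folklore] -/
theorem vspec_append (pre l₁ l₂ : List ℕ) : vspec N m r pre (l₁ ++ l₂) = vspec N m r pre l₁ ++ vspec N m r (pre ++ l₁) l₂ := by
  induction l₁ generalizing pre with
  | nil => simp [vspec]
  | cons e l ih =>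
    rw [List.cons_append, vspec, vspec, ih]
    simp only [List.append_assoc, List.cons_append, List.nil_append]

/-- A baby entry resets the record. [folklore] -/
theorem scanStep_baby (st : ScanSt) {e : ℕ} (h1 : eflag N m r e = 0) :
    scanStep N m r st e = { st with lastKey := some (ekey N m r e), lastI := epay N m r e } := by
  unfold scanStep; rw [if_pos h1]

/-- A giant entry keeps the record, extends the value list iff unmatched, keeps a found factor,
and on a match with nothing found records the recovery. [folklore] -/
theorem scanStep_giant (st : ScanSt) {e : ℕ} (h1 : eflag N m r e ≠ 0) :
    (scanStep N m r st e).lastKey = st.lastKey ∧ (scanStep N m r st e).lastI = st.lastI ∧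
    (scanStep N m r st e).vlist = (if st.lastKey = some (ekey N m r e) then st.vlist else st.vlist ++ [ekey N m r e]) ∧
    (st.found.isSome → (scanStep N m r st e).found.isSome) ∧
    (st.lastKey = some (ekey N m r e) → st.found = none →
      (scanStep N m r st e).found =
        recover N ((triples N m r).getD (epay N m r e) (0, 0, 0)).1 ((triples N m r).getD (epay N m r e) (0, 0, 0)).2.1
          (st.lastI + ((triples N m r).getD (epay N m r e) (0, 0, 0)).2.2 * m +
            cab N ((triples N m r).getD (epay N m r e) (0, 0, 0)).1 ((triples N m r).getD (epay N m r e) (0, 0, 0)).2.1)) := by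
  unfold scanStep
  rw [if_neg h1]
  by_cases h2 : st.lastKey = some (ekey N m r e)
  · simp only [h2, if_true]
    cases hf : st.found with
    | some g => simp [h2, hf]
    | none => simp
  · simp only [h2, if_false]
    simp

/-- **The fold computes the specification** (any list): the recorded baby, the value list, and
the persistence of a found factor; and a match with a successful recovery sets `found`. [folklore] -/
theorem foldl_scan_facts (l : List ℕ) :
    let st := l.foldl (scanStep N m r) ⟨none, 0, none, []⟩
    st.lastKey = lastKeyOf N m r l ∧ st.lastI = lastIOf N m r l ∧ st.vlist = vspec N m r [] l ∧
    (∀ pre e post, l = pre ++ e :: post → eflag N m r e ≠ 0 → matched N m r pre e →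
      (recover N ((triples N m r).getD (epay N m r e) (0, 0, 0)).1 ((triples N m r).getD (epay N m r e) (0, 0, 0)).2.1
        (lastIOf N m r pre + ((triples N m r).getD (epay N m r e) (0, 0, 0)).2.2 * m +
          cab N ((triples N m r).getD (epay N m r e) (0, 0, 0)).1 ((triples N m r).getD (epay N m r e) (0, 0, 0)).2.1)).isSome →
      st.found.isSome) := by
  induction l using List.reverseRecOn with
  | nil =>
    simp only [List.foldl_nil]
    refine ⟨rfl, rfl, rfl, fun pre e post h => ?_⟩
    have := congrArg List.length h; simp at this
  | append_singleton l e ih =>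
    intro st
    obtain ⟨i1, i2, i3, i4⟩ := ih
    have hst : st = scanStep N m r (l.foldl (scanStep N m r) ⟨none, 0, none, []⟩) e := by
      simp only [st, List.foldl_append, List.foldl_cons, List.foldl_nil]
    set st0 := l.foldl (scanStep N m r) ⟨none, 0, none, []⟩ with hst0
    rw [hst]
    by_cases h1 : eflag N m r e = 0
    · -- a baby entry
      rw [scanStep_baby st0 h1]
      refine ⟨?_, ?_, ?_, ?_⟩
      · rw [lastKeyOf, lastB_append_singleton, if_pos h1]; rfl
      · rw [lastIOf, lastB_append_singleton, if_pos h1]; rfl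
      · show st0.vlist = _; rw [vspec_append, ← i3]; simp [vspec, h1]
      · intro pre e' post hsplit hfl hmatch hrec
        show st0.found.isSome
        rcases List.eq_nil_or_concat post with rfl | ⟨post', x, rfl⟩
        · obtain ⟨-, h3⟩ := List.append_inj' hsplit rfl
          have : e = e' := by simpa using h3
          subst this; exact absurd h1 hfl
        · have h2 : l ++ [e] = (pre ++ e' :: post') ++ [x] := by rw [hsplit]; simp
          obtain ⟨h3, -⟩ := List.append_inj' h2 rfl
          exact i4 pre e' post' h3 hfl hmatch hrec
    · -- a giant entry
      obtain ⟨g1, g2, g3, g4, g5⟩ := scanStep_giant st0 (e := e) h1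
      refine ⟨?_, ?_, ?_, ?_⟩
      · rw [g1, i1, lastKeyOf, lastKeyOf, lastB_append_singleton, if_neg h1]
      · rw [g2, i2, lastIOf, lastIOf, lastB_append_singleton, if_neg h1]
      · rw [g3, vspec_append, ← i3, i1]
        simp only [vspec, List.nil_append, List.append_nil, h1, if_false, matched]
        split_ifs <;> simp
      · intro pre e' post hsplit hfl hmatch hrec
        rcases List.eq_nil_or_concat post with rfl | ⟨post', x, rfl⟩
        · -- `e' = e`, `pre = l`
          obtain ⟨h3, h4⟩ := List.append_inj' hsplit rfl
          have : e = e' := by simpa using h4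
          subst this; subst h3
          rw [matched, ← i1] at hmatch
          cases hf : st0.found with
          | some g => exact g4 (by rw [hf]; rfl)
          | none => rw [g5 hmatch hf, i2]; exact hrec
        · have h2 : l ++ [e] = (pre ++ e' :: post') ++ [x] := by rw [hsplit]; simp
          obtain ⟨h3, -⟩ := List.append_inj' h2 rfl
          exact g4 (i4 pre e' post' h3 hfl hmatch hrec)

end Fold

/-! ### the scan of the SORTED entries -/

section Sorted

variable {N α m r : ℕ}

/-- The baby-step keys. [folklore] -/
def BK (N α m r : ℕ) : List ℕ := (List.range m).map (baby N α m r)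

/-- Membership among the baby-step keys. [folklore] -/
theorem mem_BK {v : ℕ} : v ∈ BK N α m r ↔ ∃ i, i < m ∧ baby N α m r i = v := by
  simp [BK, List.mem_map, List.mem_range]

/-- Membership in the value list (any list, any prefix). [folklore] -/
theorem mem_vspec_iff {pre₀ l : List ℕ} {v : ℕ} :
    v ∈ vspec N m r pre₀ l ↔ ∃ l₁ e l₂, l = l₁ ++ e :: l₂ ∧ eflag N m r e ≠ 0 ∧ ¬ matched N m r (pre₀ ++ l₁) e ∧ ekey N m r e = v := by
  induction l generalizing pre₀ with
  | nil =>
    simp only [vspec, List.not_mem_nil, false_iff]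
    rintro ⟨l₁, e, l₂, h, -⟩
    have := congrArg List.length h; simp at this
  | cons x l ih =>
    rw [vspec, List.mem_append, ih]
    constructor
    · rintro (h | ⟨l₁, e, l₂, rfl, h2, h3, h4⟩)
      · refine ⟨[], x, l, rfl, ?_⟩
        by_cases hf : eflag N m r x = 0
        · simp [hf] at h
        · by_cases hm : matched N m r pre₀ x
          · simp [hf, hm] at h
          · simp only [hf, if_false, hm, List.mem_singleton] at h
            exact ⟨hf, by simpa using hm, h.symm⟩
      · exact ⟨x :: l₁, e, l₂, rfl, h2, by simpa using h3, h4⟩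
    · rintro ⟨l₁, e, l₂, h1, h2, h3, h4⟩
      rcases l₁ with _ | ⟨y, l₁⟩
      · simp only [List.nil_append, List.cons.injEq] at h1
        obtain ⟨rfl, rfl⟩ := h1
        left
        simp only [List.append_nil] at h3
        simp [h2, h3, h4]
      · simp only [List.cons_append, List.cons.injEq] at h1
        obtain ⟨rfl, rfl⟩ := h1
        right
        exact ⟨l₁, e, l₂, rfl, h2, by simpa using h3, h4⟩

/-- The recorded baby lies in the prefix and is a baby entry. [folklore] -/
theorem lastB_mem {pre : List ℕ} {e' : ℕ} (h : lastB N m r pre = some e') : e' ∈ pre ∧ eflag N m r e' = 0 := by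
  unfold lastB at h
  rw [List.getLast?_eq_some_iff] at h
  obtain ⟨ys, hys⟩ := h
  have : e' ∈ pre.filter fun e => eflag N m r e = 0 := by rw [hys]; simp
  simpa using this

/-- **Matching in sorted order is membership among the baby keys**, and the recorded index is the
baby's index (babies pairwise distinct). [folklore] -/
theorem matched_iff_of_sorted (hinj : ∀ i i', i < m → i' < m → baby N α m r i = baby N α m r i' → i = i')
    {pre post : List ℕ} {e : ℕ} (hS : sorted N α m r = pre ++ e :: post) (he : eflag N m r e ≠ 0) :
    (matched N m r pre e ↔ ekey N m r e ∈ BK N α m r) ∧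
    (matched N m r pre e → lastIOf N m r pre < m ∧ baby N α m r (lastIOf N m r pre) = ekey N m r e) := by
  have hP := lt_P_m (N := N) (m := m) (r := r)
  have hwf : ∀ x ∈ sorted N α m r, WF N α m r x := fun x hx => mem_sorted_iff.1 hx
  have hsort := sorted_pairwise_lt (N := N) (α := α) (m := m) (r := r)
  rw [hS] at hwf hsort
  rw [List.pairwise_append, List.pairwise_cons] at hsort
  obtain ⟨hpre, ⟨hepost, hpost⟩, hcross⟩ := hsort
  -- facts about the recorded baby, if any
  have hbaby : ∀ e', lastB N m r pre = some e' → ∃ i, i < m ∧ ekey N m r e' = baby N α m r i ∧ epay N m r e' = i ∧ e' ∈ pre := by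
    intro e' h
    obtain ⟨hmem, hfl⟩ := lastB_mem h
    obtain ⟨i, hi, -, hk, hp⟩ := (hwf e' (by simp [hmem])).baby_of_flag hfl
    exact ⟨i, hi, hk, hp, hmem⟩
  have part2 : matched N m r pre e → lastIOf N m r pre < m ∧ baby N α m r (lastIOf N m r pre) = ekey N m r e := by
    intro hm
    unfold matched lastKeyOf at hm
    cases hl : lastB N m r pre with
    | none => rw [hl] at hm; simp at hm
    | some e' =>
      rw [hl] at hm; simp only [Option.map_some, Option.some.injEq] at hm
      obtain ⟨i, hi, hk, hp, -⟩ := hbaby e' hl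
      have : lastIOf N m r pre = i := by unfold lastIOf; rw [hl]; simpa using hp
      rw [this]; exact ⟨hi, by rw [← hk, hm]⟩
  refine ⟨⟨fun hm => ?_, fun hmem => ?_⟩, part2⟩
  · obtain ⟨hi, hb⟩ := part2 hm
    exact mem_BK.2 ⟨_, hi, hb⟩
  · obtain ⟨i, hi, hbi⟩ := mem_BK.1 hmem
    -- the giant entry `e` and the baby entry `eb` of the same key
    obtain ⟨k, hk, heq, hke, hpe⟩ := (hwf e (by simp)).giant_of_flag he
    set eb := entry N m r (baby N α m r i) 0 i with heb
    have hebS : eb ∈ pre ++ e :: post := by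
      rw [← hS, mem_sorted_iff]; exact Or.inl ⟨i, hi, rfl⟩
    have heblt : eb < e := by rw [heq, ← hke, ← hbi]; exact entry_baby_lt_giant (by omega)
    have hebpre : eb ∈ pre := by
      rcases List.mem_append.1 hebS with h | h
      · exact h
      · rcases List.mem_cons.1 h with h | h
        · exact absurd (h ▸ heblt) (lt_irrefl _)
        · exact absurd (hepost eb h) (not_lt.2 heblt.le)
    -- so there is a recorded baby `e'`, between `eb` and `e`
    have hfil : eb ∈ pre.filter fun x => eflag N m r x = 0 := by
      rw [List.mem_filter]; exact ⟨hebpre, by simp [heb, eflag_entry two_pos (show i < P N m r by omega)]⟩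
    cases hl : lastB N m r pre with
    | none =>
      unfold lastB at hl; rw [List.getLast?_eq_none_iff] at hl
      rw [hl] at hfil; simp at hfil
    | some e' =>
      obtain ⟨i', hi', hk', hp', hmem'⟩ := hbaby e' hl
      -- `eb ≤ e'`: `e'` is last in the (sorted) filtered list
      have h1 : baby N α m r i ≤ baby N α m r i' := by
        have hge : eb ≤ e' := by
          unfold lastB at hl
          rw [List.getLast?_eq_some_iff] at hl
          obtain ⟨ys, hys⟩ := hl
          have hsf : (pre.filter fun x => eflag N m r x = 0).Pairwise (· < ·) := hpre.filter _
          rw [hys, List.pairwise_append] at hsf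
          rw [hys, List.mem_append, List.mem_singleton] at hfil
          rcases hfil with h | h
          · exact (hsf.2.2 eb h e' (by simp)).le
          · exact h.le
        have := ekey_mono (N := N) (m := m) (r := r) hge
        rwa [heb, ekey_entry two_pos (show i < P N m r by omega), hk'] at this
      -- `e' < e`
      have h2 : baby N α m r i' ≤ baby N α m r i := by
        have := ekey_mono (N := N) (m := m) (r := r) (hcross e' hmem' e (by simp)).le
        rw [hk', ← hbi] at this
        exact this
      have h3 : i' = i := hinj i' i hi' hi (le_antisymm h2 h1)
      subst h3
      unfold matched lastKeyOf; rw [hl]; simp [hk', hbi]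

/-- **The value list is the list of unmatched giant-step values.** [folklore] -/
theorem mem_vlist_iff (hinj : ∀ i i', i < m → i' < m → baby N α m r i = baby N α m r i' → i = i') {v : ℕ} :
    v ∈ (scanAll N α m r).vlist ↔ (∃ k, k < (triples N m r).length ∧ giant N α m r ((triples N m r).getD k (0, 0, 0)) = v) ∧ v ∉ BK N α m r := by
  obtain ⟨-, -, h3, -⟩ := foldl_scan_facts (N := N) (m := m) (r := r) (sorted N α m r)
  unfold scanAll; rw [h3, mem_vspec_iff]
  constructor
  · rintro ⟨l₁, e, l₂, hS, hfl, hnm, hk⟩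
    rw [List.nil_append] at hnm
    obtain ⟨h1, -⟩ := matched_iff_of_sorted hinj hS hfl
    have hwf : WF N α m r e := mem_sorted_iff.1 (by rw [hS]; simp)
    obtain ⟨k, hk', -, hke, -⟩ := hwf.giant_of_flag hfl
    exact ⟨⟨k, hk', by rw [← hke, hk]⟩, fun hmem => hnm (h1.2 (hk ▸ hmem))⟩
  · rintro ⟨⟨k, hk, hkv⟩, hnot⟩
    set e := entry N m r (giant N α m r ((triples N m r).getD k (0, 0, 0))) 1 k with he
    have heS : e ∈ sorted N α m r := mem_sorted_iff.2 (Or.inr ⟨k, hk, rfl⟩)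
    obtain ⟨l₁, l₂, hS⟩ := List.append_of_mem heS
    have hP := lt_P_m (N := N) (m := m) (r := r)
    have hfl : eflag N m r e ≠ 0 := by rw [he, eflag_entry one_lt_two (by omega)]; exact one_ne_zero
    have hke : ekey N m r e = v := by rw [he, ekey_entry one_lt_two (by omega), hkv]
    obtain ⟨h1, -⟩ := matched_iff_of_sorted hinj hS hfl
    exact ⟨l₁, e, l₂, hS, hfl, by rw [List.nil_append]; exact fun hm => hnot (hke ▸ h1.1 hm), hke⟩

/-- **An exact match with a successful recovery sets `found`.** [folklore] -/
theorem found_of_exact (hinj : ∀ i i', i < m → i' < m → baby N α m r i = baby N α m r i' → i = i')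
    {k i₀ : ℕ} (hk : k < (triples N m r).length) (hi₀ : i₀ < m)
    (hexact : giant N α m r ((triples N m r).getD k (0, 0, 0)) = baby N α m r i₀)
    (hrec : (recover N ((triples N m r).getD k (0, 0, 0)).1 ((triples N m r).getD k (0, 0, 0)).2.1
      (i₀ + ((triples N m r).getD k (0, 0, 0)).2.2 * m + cab N ((triples N m r).getD k (0, 0, 0)).1 ((triples N m r).getD k (0, 0, 0)).2.1)).isSome) :
    (scanAll N α m r).found.isSome := by
  obtain ⟨-, -, -, h4⟩ := foldl_scan_facts (N := N) (m := m) (r := r) (sorted N α m r)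
  set e := entry N m r (giant N α m r ((triples N m r).getD k (0, 0, 0))) 1 k with he
  have heS : e ∈ sorted N α m r := mem_sorted_iff.2 (Or.inr ⟨k, hk, rfl⟩)
  obtain ⟨l₁, l₂, hS⟩ := List.append_of_mem heS
  have hP := lt_P_m (N := N) (m := m) (r := r)
  have hfl : eflag N m r e ≠ 0 := by rw [he, eflag_entry one_lt_two (by omega)]; exact one_ne_zero
  have hke : ekey N m r e = baby N α m r i₀ := by rw [he, ekey_entry one_lt_two (by omega), hexact]
  have hpe : epay N m r e = k := by rw [he, epay_entry (by omega)]
  obtain ⟨h1, h2⟩ := matched_iff_of_sorted hinj hS hfl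
  have hm : matched N m r l₁ e := h1.2 (hke ▸ mem_BK.2 ⟨i₀, hi₀, rfl⟩)
  obtain ⟨hi, hb⟩ := h2 hm
  have hii : lastIOf N m r l₁ = i₀ := hinj _ _ hi hi₀ (by rw [hb, hke])
  unfold scanAll
  refine h4 l₁ e l₂ hS hfl hm ?_
  rw [hpe, hii]; exact hrec

end Sorted

/-! ### completeness -/

section Complete

variable {N α m r : ℕ}

/-- Residues modulo `N` seen modulo a divisor `p`. [folklore] -/
theorem cast_mod_of_dvd {p x : ℕ} (hpN : p ∣ N) : ((x % N : ℕ) : ZMod p) = (x : ZMod p) := by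
  rw [ZMod.natCast_eq_natCast_iff', Nat.mod_mod_of_dvd _ hpN]

/-- A baby step modulo a prime factor: `C α^i`. [folklore] -/
theorem cast_baby {p : ℕ} (hpN : p ∣ N) (i : ℕ) :
    ((baby N α m r i : ℕ) : ZMod p) = (α : ZMod p) ^ ((Jmax N m r - 1) * m) * (α : ZMod p) ^ i := by
  unfold baby Cst
  rw [cast_mod_of_dvd hpN, Nat.cast_mul, cast_mod_of_dvd hpN, cast_mod_of_dvd hpN]
  push_cast; rfl

/-- A giant step modulo a prime factor: `t_{a,b} α^{(J*−1−j)m}`. [folklore] -/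
theorem cast_giant {p : ℕ} (hpN : p ∣ N) (a b j : ℕ) :
    ((giant N α m r (a, b, j) : ℕ) : ZMod p) = (α : ZMod p) ^ (a * N + b - cab N a b) * (α : ZMod p) ^ ((Jmax N m r - 1 - j) * m) := by
  unfold giant tval
  rw [cast_mod_of_dvd hpN, Nat.cast_mul, cast_mod_of_dvd hpN, cast_mod_of_dvd hpN]
  push_cast; rfl

/-- Baby steps are reduced. [folklore] -/
theorem baby_lt (hN : 0 < N) (i : ℕ) : baby N α m r i < N := Nat.mod_lt _ hN

/-- Giant steps are reduced. [folklore] -/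
theorem giant_lt (hN : 0 < N) (t : ℕ × ℕ × ℕ) : giant N α m r t < N := Nat.mod_lt _ hN

/-- The triple `(a, b, j)` is enumerated. [folklore] -/
theorem mem_triples {a b j : ℕ} (ha : 0 < a) (hb : 0 < b) (hab : a * b ≤ r) (hj : j < Jab N r m a b) :
    (a, b, j) ∈ triples N m r := by
  unfold triples pairs
  simp only [List.mem_flatMap, List.mem_map, List.mem_range, Prod.exists]
  refine ⟨a, b, ⟨a - 1, ?_, b - 1, ?_, ?_⟩, j, hj, rfl⟩
  · have : a ≤ a * b := Nat.le_mul_of_pos_right _ hb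
    omega
  · rw [Nat.sub_add_cancel ha, Nat.lt_iff_add_one_le, Nat.sub_add_cancel hb, Nat.le_div_iff_mul_le ha, Nat.mul_comm]
    exact hab
  · rw [Nat.sub_add_cancel ha, Nat.sub_add_cancel hb]

/-- **Completeness of the merged search** (Harvey 2021, proof of Prop. 4.2 with the collision
step of Prop. 4.1): for `N = pq`, `p < q` primes with `a, b ≤ r < p` guaranteed by `r < p`,
Lehman's range `(N/r)^{1/2} ≤ p`, and a base `α` coprime to `N` whose powers `α^x`, `1 ≤ x < m`,
are `≠ 1` modulo EVERY prime factor (the certificate of the order supply), the search reports a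
factor. [folklore] -/
theorem bsgsOut_complete {p q : ℕ} (hp : p.Prime) (hq : q.Prime) (hpq : p < q) (hN : N = p * q)
    (hr : 0 < r) (hm : 0 < m) (hrp : r < p) (hlow : Real.sqrt ((N : ℝ) / r) ≤ p)
    (hαN : Nat.Coprime α N) (hord : ∀ p', p'.Prime → p' ∣ N → ∀ x, 1 ≤ x → x < m → (α : ZMod p') ^ x ≠ 1) :
    (bsgsOut N α m r).isSome := by
  haveI := Fact.mk hp
  have hp2 := hp.two_le
  have hq2 := hq.two_le
  have hN1 : 1 < N := by rw [hN]; nlinarith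
  haveI : NeZero N := ⟨by omega⟩
  have hN0 : 0 < N := by omega
  have hpN : p ∣ N := ⟨q, hN⟩
  -- `α ≠ 0` modulo `p`
  have hα : (α : ZMod p) ≠ 0 := by
    intro h0
    have hpa : p ∣ α := (ZMod.natCast_eq_zero_iff α p).1 h0
    have : p ∣ Nat.gcd α N := Nat.dvd_gcd hpa hpN
    rw [hαN] at this
    exact hp.one_lt.ne' (Nat.dvd_one.1 this)
  -- powers below `m` are distinct modulo `p`
  have hpowinj : ∀ i i', i < m → i' < m → (α : ZMod p) ^ i = (α : ZMod p) ^ i' → i = i' := by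
    intro i i' hi hi' he
    wlog hle : i ≤ i' generalizing i i'
    · exact (this i' i hi' hi he.symm (by omega)).symm
    rcases Nat.eq_or_lt_of_le hle with rfl | hlt
    · rfl
    · exfalso
      have h1 : (α : ZMod p) ^ i' = (α : ZMod p) ^ i * (α : ZMod p) ^ (i' - i) := by rw [← pow_add]; congr 1; omega
      rw [h1] at he
      have h2 : (α : ZMod p) ^ (i' - i) = 1 := (mul_right_inj' (pow_ne_zero _ hα)).1 (by rw [← he, mul_one])
      exact hord p hp hpN (i' - i) (by omega) (by omega) h2
  have hC : (α : ZMod p) ^ ((Jmax N m r - 1) * m) ≠ 0 := pow_ne_zero _ hα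
  have hinj : ∀ i i', i < m → i' < m → baby N α m r i = baby N α m r i' → i = i' := by
    intro i i' hi hi' he
    have := congrArg (fun x : ℕ => (x : ZMod p)) he
    simp only [cast_baby hpN] at this
    exact hpowinj i i' hi hi' ((mul_right_inj' hC).1 this)
  -- the witness of Lemma 3.3 / Prop. 4.2
  have hup : (p : ℝ) < Real.sqrt N := by
    rw [Real.lt_sqrt (by positivity), hN]; push_cast
    have h1 : p * p < p * q := (Nat.mul_lt_mul_left hp.pos).2 hpq
    rw [sq]; exact_mod_cast h1
  obtain ⟨a, b, i₀, j, ha, hb, hab, hi₀, hj, hc1, -, hu, hrel⟩ :=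
    bsgs_witness (Jmax := Jmax N m r) hq.pos hr hm hN hlow hup (fun a b ha hb _ => Jab_le_Jab_one ha hb) hα
  have hap : a < p := by nlinarith
  have hbq : b < q := by nlinarith
  -- its index among the triples
  obtain ⟨k, hk, htk⟩ : ∃ k, k < (triples N m r).length ∧ (triples N m r).getD k (0, 0, 0) = (a, b, j) := by
    obtain ⟨k, hk, he⟩ := List.getElem_of_mem (mem_triples ha hb hab hj)
    exact ⟨k, hk, by rw [List.getD_eq_getElem _ _ hk, he]⟩
  -- the congruence modulo `p`
  have hcong : ((baby N α m r i₀ : ℕ) : ZMod p) = ((giant N α m r (a, b, j) : ℕ) : ZMod p) := by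
    rw [cast_baby hpN, cast_giant hpN, ← pow_add, hrel, mul_comm]
  by_cases hex : giant N α m r (a, b, j) = baby N α m r i₀
  · -- exact match: the recovery of Lemma 3.1 succeeds when the scan reaches it
    have hrec : (recover N a b (i₀ + j * m + cab N a b)).isSome := by
      obtain ⟨r1, r2, r3⟩ := lemma31_integer hp hq hN ha hb hap hbq hu
      unfold recover; rw [if_pos r1, if_pos r2, if_pos r3]; rfl
    have hf := found_of_exact hinj hk hi₀ (by rw [htk]; exact hex) (by rw [htk]; exact hrec)
    unfold bsgsOut
    obtain ⟨g, hg⟩ := Option.isSome_iff_exists.1 hf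
    rw [hg]; rfl
  · -- no exact match: the giant step is an unmatched value, and the collision search finds `p`
    have hnotBK : giant N α m r (a, b, j) ∉ BK N α m r := by
      intro hmem
      obtain ⟨i', hi', he'⟩ := mem_BK.1 hmem
      have h1 : ((baby N α m r i' : ℕ) : ZMod p) = ((baby N α m r i₀ : ℕ) : ZMod p) := by rw [he', ← hcong]
      rw [cast_baby hpN, cast_baby hpN] at h1
      have := hpowinj i' i₀ hi' hi₀ ((mul_right_inj' hC).1 h1)
      subst this
      exact hex he'.symm
    have hv : giant N α m r (a, b, j) ∈ (scanAll N α m r).vlist := (mem_vlist_iff hinj).2 ⟨⟨k, hk, by rw [htk]⟩, hnotBK⟩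
    unfold bsgsOut
    cases hfound : (scanAll N α m r).found with
    | some g => rfl
    | none =>
      show (alg1 N α m r (scanAll N α m r).vlist).isSome
      set vl := (scanAll N α m r).vlist with hvl
      have hvlN : ∀ v ∈ vl, v < N ∧ v ∉ BK N α m r := by
        intro v hv'
        obtain ⟨⟨k', -, hk'⟩, hnb⟩ := (mem_vlist_iff hinj).1 hv'
        exact ⟨hk' ▸ giant_lt hN0 _, hnb⟩
      have hval : ∀ i, i < m → (vals N α m r vl).getD i 0 = ((fpoly N vl).eval ((baby N α m r i : ℕ) : ZMod N)).val := by
        intro i hi; unfold vals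
        rw [List.getD_eq_getElem _ _ (by simpa using hi), List.getElem_map, List.getElem_range]
      -- `p ∣ f(baby i₀)`
      have hdiv : p ∣ (vals N α m r vl).getD i₀ 0 := by
        rw [hval i₀ hi₀]
        set y := (fpoly N vl).eval ((baby N α m r i₀ : ℕ) : ZMod N) with hy
        have h0 : ZMod.castHom hpN (ZMod p) y = 0 := by
          rw [hy, fpoly, Polynomial.eval_list_prod, map_list_prod, List.map_map, List.map_map]
          apply List.prod_eq_zero
          rw [List.mem_map]
          refine ⟨giant N α m r (a, b, j), hv, ?_⟩
          simp only [Function.comp_apply, Polynomial.eval_sub, Polynomial.eval_X, Polynomial.eval_natCast, map_sub, map_natCast]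
          rw [hcong, sub_self]
        rw [ZMod.castHom_apply, ZMod.cast_eq_val] at h0
        exact (ZMod.natCast_eq_zero_iff _ _).1 h0
      have hgt : 1 < Nat.gcd ((vals N α m r vl).getD i₀ 0) N := by
        have h1 : p ∣ Nat.gcd ((vals N α m r vl).getD i₀ 0) N := Nat.dvd_gcd hdiv hpN
        have h2 : 0 < Nat.gcd ((vals N α m r vl).getD i₀ 0) N := Nat.gcd_pos_of_pos_right _ hN0
        have := Nat.le_of_dvd h2 h1
        omega
      -- the first hit `i*`
      have hsome : ((List.range m).find? fun i => 1 < Nat.gcd ((vals N α m r vl).getD i 0) N).isSome := by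
        rw [List.find?_isSome]; exact ⟨i₀, List.mem_range.2 hi₀, by simpa using hgt⟩
      obtain ⟨istar, histar⟩ := Option.isSome_iff_exists.1 hsome
      have hhit : 1 < Nat.gcd ((vals N α m r vl).getD istar 0) N := by simpa using List.find?_some histar
      have histar_m : istar < m := List.mem_range.1 (List.mem_of_find?_eq_some histar)
      unfold alg1
      rw [histar]
      simp only
      by_cases hlt : Nat.gcd ((vals N α m r vl).getD istar 0) N < N
      · rw [if_pos hlt]; rfl
      · rw [if_neg hlt]
        -- `gcd = N`: the product vanishes in `ℤ/N`
        have hgN : Nat.gcd ((vals N α m r vl).getD istar 0) N = N :=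
          le_antisymm (Nat.gcd_le_right _ hN0) (not_lt.1 hlt)
        have hz : (fpoly N vl).eval ((baby N α m r istar : ℕ) : ZMod N) = 0 := by
          have h1 := Nat.gcd_dvd_left ((vals N α m r vl).getD istar 0) N
          rw [hgN, hval istar histar_m] at h1
          have h3 := Nat.eq_zero_of_dvd_of_lt h1 (ZMod.val_lt _)
          exact (ZMod.val_eq_zero _).1 h3
        rw [fpoly, Polynomial.eval_list_prod, List.map_map] at hz
        have hz' : (vl.map fun v => ((baby N α m r istar : ℕ) : ZMod N) - ((v : ℕ) : ZMod N)).prod = 0 := by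
          rw [← hz]; congr 1
          refine List.map_congr_left fun v _ => ?_
          simp [Polynomial.eval_sub, Polynomial.eval_X]
        obtain ⟨v, hvmem, hvunit⟩ := exists_not_isUnit_of_prod_eq_zero hN1 vl (fun v => ((v : ℕ) : ZMod N)) _ hz'
        obtain ⟨hvN, hvBK⟩ := hvlN v hvmem
        set b₀ := baby N α m r istar with hb₀
        have hb₀N : b₀ < N := baby_lt hN0 _
        set x := (b₀ + N - v) % N with hx
        have hxcast : ((x : ℕ) : ZMod N) = ((b₀ : ℕ) : ZMod N) - ((v : ℕ) : ZMod N) := by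
          rw [hx, ZMod.natCast_mod, Nat.cast_sub (by omega), Nat.cast_add, ZMod.natCast_self, add_zero]
        have hx0 : x ≠ 0 := by
          intro h0
          have h1 : ((b₀ : ℕ) : ZMod N) = ((v : ℕ) : ZMod N) := sub_eq_zero.1 (by rw [← hxcast, h0, Nat.cast_zero])
          have h2 := (ZMod.natCast_eq_natCast_iff' b₀ v N).1 h1
          rw [Nat.mod_eq_of_lt hb₀N, Nat.mod_eq_of_lt hvN] at h2
          exact hvBK (mem_BK.2 ⟨istar, histar_m, h2⟩)
        have hxN : x < N := Nat.mod_lt _ hN0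
        have hgx : 1 < Nat.gcd x N ∧ Nat.gcd x N < N := by
          rw [← hxcast, ZMod.isUnit_iff_coprime] at hvunit
          have h1 : 0 < Nat.gcd x N := Nat.gcd_pos_of_pos_right _ hN0
          have h2 : Nat.gcd x N ≤ x := Nat.gcd_le_left _ (by omega)
          rw [Nat.Coprime] at hvunit
          omega
        have hfind : (vl.find? fun v => 1 < Nat.gcd ((baby N α m r istar + N - v) % N) N ∧ Nat.gcd ((baby N α m r istar + N - v) % N) N < N).isSome := by
          rw [List.find?_isSome]; exact ⟨v, hvmem, by simpa [← hb₀, ← hx] using hgx⟩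
        obtain ⟨v', hv'⟩ := Option.isSome_iff_exists.1 hfind
        rw [hv']; rfl

end Complete

end SearchModel

end Literature.Computability.Cryptography.Harvey2021
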